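import Mathlib
import HarnessLib
import Summits.HubbardSuperconductivity.HubbardSuperconductivity.Theorems.KLProgrammePerturbedFermiCurveTwoFrameGraded
import Summits.HubbardSuperconductivity.HubbardSuperconductivity.Theorems.KLProgrammePerturbedFermiCurveCompDiff

/-!
# Route `KLProgramme` — K3 engine child (stmt-HubbardSuperconductivity-19918, `stub_twoLeg_step`, clause (E3a-MS) `TwoLegSizesMST`):
# the composite difference `∂ʲ(F∘γ_{K′}) − ∂ʲ(F∘γ_K)` in GRADED form, with numerals — the one-call form of (P2)

Cell `gate-hubbard-kl`, seat hubbard-kl-k3c3-p3 (g3) «implicit-function / monotonicity route for μ(n)», part (P2) of the (L)+(F) recipe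
(k3c3-p1 MS-DESIGN-NOTE §3, plan g12 ruling STATUS l.1769).  This is the lemma the slot bookkeeping of (P4) calls once per slot: two
`C²`-small frames `K, K′` at a common level `ν` with common sizes `A ≤ 1/20`, `A₃ ≤ λ`, `A₄ ≤ λ²` (`λ ≥ 1`), difference sizes `E_i ≤ e·λ^i`
(nested, on the closed square), and a `C⁵` symbol `F : Momentum → ℝ` with GLOBAL nested derivative bounds `‖DᵏF‖ ≤ M_k` (`k = 1 … 5`;
for the scale-`n` increment interpolant these are its coefficient moments, `M₅` = the (O1) moment).  With `γ_K θ = toLp 2 (klFermiPoint ν K θ)`: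

* `abs_comp_sub_le_graded_zero`:  `|F(γ_{K′}θ) − F(γ_Kθ)| ≤ 12.2·M₁·e`;
* `abs_iteratedDeriv_comp_sub_le_graded_one`:   `|∂¹…| ≤ e·(3.78·10⁴·M₁λ + 2.82·10³·M₂)`;
* `abs_iteratedDeriv_comp_sub_le_graded_two`:   `|∂²…| ≤ e·(3.52·10⁸·M₁λ² + 2.61·10⁷·M₂λ + 6.52·10⁵·M₃)`;
* `abs_iteratedDeriv_comp_sub_le_graded_three`: `|∂³…| ≤ e·(5.45·10¹²·M₁λ³ + 4.05·10¹¹·M₂λ² + 1.2·10¹⁰·M₃λ + 1.51·10⁸·M₄)`;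
* `abs_iteratedDeriv_comp_sub_le_graded_four`:  `|∂⁴…| ≤ e·(1.19·10¹⁷·M₁λ⁴ + 8.79·10¹⁵·M₂λ³ + 2.8·10¹⁴·M₃λ² + 4.6·10¹²·M₄λ + 3.48·10¹⁰·M₅)
  + 6.92·10¹⁰·M₁·A₄`

— i.e. order `j` costs `e·Σ_{k ≤ j+1} C_{j,k}·M_k·λ^{j+1−k}` plus, at order 4, the one term `M₁·A₄` not carrying the difference size `e`
(the fourth derivative of the base frame is bounded, not Lipschitz).  In slot `m` of (F): `λ = 4^m`, `e ≍` the sup of the high part of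
piece `m`, `M_k ≍ μ_k U² 4^{(k−2)n}`, so `M_k λ^{j+1−k} e ≍ μ_k U² 4^{−n}·4^{(j−2)m}·4^{(k−1)(n−m)}·(e·16^m)`: the `k = 1` term is the slot
budget shape `msBar n · 4^{(j−2)m}` and `k ≥ 2` is smaller by `4^{(k−1)(n−m)}`.
Assembled from `…CompDiff` (`abs_iteratedDeriv_*_comp_sub_le`, `norm_fderiv*_sub_le_of_global`), `…TwoFrameGraded`, `…TowerOfSizes`,
`…Numerics`; §0 is the `iteratedDeriv`/`iteratedFDeriv` dictionary for differences.  Everything is PROVED; no definitions, no named facts.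
[cite: BenfattoGiulianiMastropietro2006, §2.4 Lemma 2.1 (2.40)]
-/

noncomputable section

namespace Summit.HubbardSuperconductivity.HubbardSuperconductivity.Theorems.PerturbedFermiCurve

set_option linter.dupNamespace false -- summit = problem name (single-conjunct summit), D-0017
set_option maxSynthPendingDepth 4 -- nested operator-norm instances (up to fifth Fréchet derivatives)

open Real Set
open Literature.MathematicalPhysics.QuantumLattice Literature.MathematicalPhysics.QuantumLattice.BandSectorCounting
open Summit.HubbardSuperconductivity.HubbardSuperconductivity.Theorems.DispersionFlow
open Summit.HubbardSuperconductivity.HubbardSuperconductivity.Theorems.KLRegimeSplit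

/-! ## §0 Differences: `iteratedDeriv` versus `iteratedFDeriv` -/

/-- `‖g^{(n)}(x) − f^{(n)}(x)‖ = ‖Dⁿg(x) − Dⁿf(x)‖` for curves `f, g : ℝ → V`. [folklore] -/
theorem norm_iteratedDeriv_sub_eq_norm_iteratedFDeriv_sub {V : Type*} [NormedAddCommGroup V] [NormedSpace ℝ V] {f g : ℝ → V}
    {n : ℕ} {x : ℝ} (hf : ContDiffAt ℝ n f x) (hg : ContDiffAt ℝ n g x) :
    ‖iteratedDeriv n g x - iteratedDeriv n f x‖ = ‖iteratedFDeriv ℝ n g x - iteratedFDeriv ℝ n f x‖ := by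
  have h : iteratedDeriv n g x - iteratedDeriv n f x = iteratedDeriv n (g - f) x := by
    simp only [iteratedDeriv_eq_iteratedFDeriv, iteratedFDeriv_sub_apply hg hf, sub_apply]
  rw [h, ← norm_iteratedFDeriv_eq_norm_iteratedDeriv, iteratedFDeriv_sub_apply hg hf]

/-- Graded domination with a nonnegative weight: `M·(e·λ^p) ≤ M·(e·λ^k)` for `p ≤ k`. [folklore] -/
theorem graded_mono_mul {M e l : ℝ} (hM : 0 ≤ M) (he : 0 ≤ e) (hl : 1 ≤ l) {p k : ℕ} (hpk : p ≤ k) :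
    M * (e * l ^ p) ≤ M * (e * l ^ k) :=
  mul_le_mul_of_nonneg_left (graded_mono he hl hpk) hM

/-! ## §1 The data of the two curves in `iteratedDeriv` form -/

section CompGraded

variable {K K' : TrigPolyC4v} {A : ℝ}
  (hA : ∀ p : Momentum, ∀ j ≤ 2, ‖iteratedFDeriv ℝ j (frameShift K) p‖ ≤ A)
  (hA' : ∀ p : Momentum, ∀ j ≤ 2, ‖iteratedFDeriv ℝ j (frameShift K') p‖ ≤ A) (hA20 : A ≤ 1 / 20)
  (hd : klCurveD ≤ (bandBounds (show (-4 : ℝ) < -1.1 by norm_num) (show (-1.1 : ℝ) ≤ -0.1 by norm_num)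
    (show (-0.1 : ℝ) < 0 by norm_num)).Dtmin - 2 * A)
  {ν : ℝ} (hlo : (-1.1 : ℝ) ≤ ν - A) (hhi : ν + A ≤ -0.1)
  {A₃ A₄ e l : ℝ} (he : 0 ≤ e) (hl : 1 ≤ l)
  (hA₃ : ∀ p : Momentum, ‖iteratedFDeriv ℝ 3 (frameShift K) p‖ ≤ A₃)
  (hA₃' : ∀ p : Momentum, ‖iteratedFDeriv ℝ 3 (frameShift K') p‖ ≤ A₃) (hA₃l : A₃ ≤ l)
  (hA₄ : ∀ p : Momentum, ‖iteratedFDeriv ℝ 4 (frameShift K) p‖ ≤ A₄)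
  (hA₄' : ∀ p : Momentum, ‖iteratedFDeriv ℝ 4 (frameShift K') p‖ ≤ A₄) (hA₄l : A₄ ≤ l ^ 2)
  (hE₀ : ∀ k : Fin 2 → ℝ, (∀ i, |k i| ≤ π) → |(fun p : Fin 2 → ℝ => -K'.eval p) k - (fun p : Fin 2 → ℝ => -K.eval p) k| ≤ e)
  (hE₁ : ∀ k : Fin 2 → ℝ, (∀ i, |k i| ≤ π) →
    ‖fderiv ℝ (fun p : Fin 2 → ℝ => -K'.eval p) k - fderiv ℝ (fun p : Fin 2 → ℝ => -K.eval p) k‖ ≤ e * l)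
  (hE₂ : ∀ k : Fin 2 → ℝ, (∀ i, |k i| ≤ π) →
    ‖fderiv ℝ (fderiv ℝ (fun p : Fin 2 → ℝ => -K'.eval p)) k - fderiv ℝ (fderiv ℝ (fun p : Fin 2 → ℝ => -K.eval p)) k‖ ≤ e * l ^ 2)
  (hE₃ : ∀ k : Fin 2 → ℝ, (∀ i, |k i| ≤ π) →
    ‖fderiv ℝ (fderiv ℝ (fderiv ℝ (fun p : Fin 2 → ℝ => -K'.eval p))) k -
      fderiv ℝ (fderiv ℝ (fderiv ℝ (fun p : Fin 2 → ℝ => -K.eval p))) k‖ ≤ e * l ^ 3)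
  (hE₄ : ∀ k : Fin 2 → ℝ, (∀ i, |k i| ≤ π) →
    ‖fderiv ℝ (fderiv ℝ (fderiv ℝ (fderiv ℝ (fun p : Fin 2 → ℝ => -K'.eval p)))) k -
      fderiv ℝ (fderiv ℝ (fderiv ℝ (fderiv ℝ (fun p : Fin 2 → ℝ => -K.eval p)))) k‖ ≤ e * l ^ 4)
include hA hA' hA20 hd hlo hhi he hl hA₃ hA₃' hA₃l hA₄ hA₄' hA₄l hE₀ hE₁ hE₂ hE₃ hE₄

/-- **The two curves in `iteratedDeriv` form, graded**: `γ_K, γ_{K′}` are `C⁴`; `‖γ⁽¹⁾‖ ≤ 231`, `‖γ⁽²⁾‖ ≤ 7·10⁵`, `‖γ⁽³⁾‖ ≤ 6.66·10⁹·λ`,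
`‖γ⁽⁴⁾‖ ≤ 1.03736·10¹⁴·λ²` (both curves); `‖γ_{K′} − γ_K‖ ≤ 12.2e`; `‖γ_{K′}⁽ⁱ⁾ − γ_K⁽ⁱ⁾‖ ≤ 3.78·10⁴eλ, 3.52·10⁸eλ², 5.45·10¹²eλ³,
1.19·10¹⁷eλ⁴ + 6.92·10¹⁰A₄`. [folklore] -/
theorem comp_graded_data (θ : ℝ) :
    ContDiff ℝ 4 (fun θ : ℝ => (WithLp.toLp 2 (klFermiPoint ν K θ) : Momentum)) ∧
    ContDiff ℝ 4 (fun θ : ℝ => (WithLp.toLp 2 (klFermiPoint ν K' θ) : Momentum)) ∧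
    (‖iteratedDeriv 1 (fun θ : ℝ => (WithLp.toLp 2 (klFermiPoint ν K θ) : Momentum)) θ‖ ≤ 231 ∧
      ‖iteratedDeriv 1 (fun θ : ℝ => (WithLp.toLp 2 (klFermiPoint ν K' θ) : Momentum)) θ‖ ≤ 231 ∧
      ‖iteratedDeriv 2 (fun θ : ℝ => (WithLp.toLp 2 (klFermiPoint ν K θ) : Momentum)) θ‖ ≤ 700000 ∧
      ‖iteratedDeriv 2 (fun θ : ℝ => (WithLp.toLp 2 (klFermiPoint ν K' θ) : Momentum)) θ‖ ≤ 700000 ∧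
      ‖iteratedDeriv 3 (fun θ : ℝ => (WithLp.toLp 2 (klFermiPoint ν K θ) : Momentum)) θ‖ ≤ 6660000000 * l ∧
      ‖iteratedDeriv 3 (fun θ : ℝ => (WithLp.toLp 2 (klFermiPoint ν K' θ) : Momentum)) θ‖ ≤ 6660000000 * l ∧
      ‖iteratedDeriv 4 (fun θ : ℝ => (WithLp.toLp 2 (klFermiPoint ν K' θ) : Momentum)) θ‖ ≤ 103736000000000 * l ^ 2) ∧
    ‖(WithLp.toLp 2 (klFermiPoint ν K' θ) : Momentum) - WithLp.toLp 2 (klFermiPoint ν K θ)‖ ≤ 12.2 * e ∧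
    ‖iteratedDeriv 1 (fun θ : ℝ => (WithLp.toLp 2 (klFermiPoint ν K' θ) : Momentum)) θ -
        iteratedDeriv 1 (fun θ : ℝ => (WithLp.toLp 2 (klFermiPoint ν K θ) : Momentum)) θ‖ ≤ 37800 * e * l ∧
    ‖iteratedDeriv 2 (fun θ : ℝ => (WithLp.toLp 2 (klFermiPoint ν K' θ) : Momentum)) θ -
        iteratedDeriv 2 (fun θ : ℝ => (WithLp.toLp 2 (klFermiPoint ν K θ) : Momentum)) θ‖ ≤ 352000000 * e * l ^ 2 ∧
    ‖iteratedDeriv 3 (fun θ : ℝ => (WithLp.toLp 2 (klFermiPoint ν K' θ) : Momentum)) θ -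
        iteratedDeriv 3 (fun θ : ℝ => (WithLp.toLp 2 (klFermiPoint ν K θ) : Momentum)) θ‖ ≤ 5450000000000 * e * l ^ 3 ∧
    ‖iteratedDeriv 4 (fun θ : ℝ => (WithLp.toLp 2 (klFermiPoint ν K' θ) : Momentum)) θ -
        iteratedDeriv 4 (fun θ : ℝ => (WithLp.toLp 2 (klFermiPoint ν K θ) : Momentum)) θ‖ ≤
      119000000000000000 * e * l ^ 4 + 69200000000 * A₄ := by
  have hA₃0 : 0 ≤ A₃ := (norm_nonneg _).trans (hA₃ 0)
  have hA₄0 : 0 ≤ A₄ := (norm_nonneg _).trans (hA₄ 0)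
  have hl0 : 0 ≤ l := zero_le_one.trans hl
  have hl2 : 1 ≤ l ^ 2 := one_le_pow₀ hl
  obtain ⟨hγ, g1, g2, g3, g4⟩ := fermiPointLp_sizes_of_sizes hA hA20 hd hlo hhi hA₃ hA₄ θ
  obtain ⟨hγ', g1', g2', g3', g4'⟩ := fermiPointLp_sizes_of_sizes hA' hA20 hd hlo hhi hA₃' hA₄' θ
  obtain ⟨d0, d1, d2, d3, d4⟩ := norm_iteratedFDeriv_fermiPointLp_sub_le_graded hA hA' hA20 hd hlo hhi he hl hA₃ hA₃' hA₃l hA₄ hA₄'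
    hA₄l hE₀ hE₁ hE₂ hE₃ hE₄ θ
  have hD1 := klCurveD1_le
  have hD2 := klCurveD2_le
  have hD3 : klCurveD3 A₃ ≤ 6660000000 * l := (klCurveD3_le hA₃0).trans (by nlinarith)
  have hD4 : klCurveD4 A₃ A₄ ≤ 103736000000000 * l ^ 2 := (klCurveD4_le hA₃0 hA₄0).trans (by nlinarith)
  have c := fun (n : ℕ) (hn : (n : WithTop ℕ∞) ≤ 4) =>
    norm_iteratedDeriv_sub_eq_norm_iteratedFDeriv_sub (hγ.contDiffAt.of_le hn) (hγ'.contDiffAt.of_le hn) (x := θ)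
  refine ⟨hγ, hγ', ⟨?_, ?_, ?_, ?_, ?_, ?_, ?_⟩, d0, ?_, ?_, ?_, ?_⟩
  · rw [← norm_iteratedFDeriv_eq_norm_iteratedDeriv]; exact g1.trans hD1
  · rw [← norm_iteratedFDeriv_eq_norm_iteratedDeriv]; exact g1'.trans hD1
  · rw [← norm_iteratedFDeriv_eq_norm_iteratedDeriv]; exact g2.trans hD2
  · rw [← norm_iteratedFDeriv_eq_norm_iteratedDeriv]; exact g2'.trans hD2
  · rw [← norm_iteratedFDeriv_eq_norm_iteratedDeriv]; exact g3.trans hD3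
  · rw [← norm_iteratedFDeriv_eq_norm_iteratedDeriv]; exact g3'.trans hD3
  · rw [← norm_iteratedFDeriv_eq_norm_iteratedDeriv]; exact g4'.trans hD4
  · rw [c 1 (by norm_num)]; exact d1
  · rw [c 2 (by norm_num)]; exact d2
  · rw [c 3 (by norm_num)]; exact d3
  · rw [c 4 (by norm_num)]; exact d4

/-! ## §2 The composite differences, graded -/

variable {F : Momentum → ℝ} (hF : ContDiff ℝ 5 F) {M₁ M₂ M₃ M₄ M₅ : ℝ}
  (hM₁ : ∀ z, ‖fderiv ℝ F z‖ ≤ M₁) (hM₂ : ∀ z, ‖fderiv ℝ (fderiv ℝ F) z‖ ≤ M₂)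
  (hM₃ : ∀ z, ‖fderiv ℝ (fderiv ℝ (fderiv ℝ F)) z‖ ≤ M₃) (hM₄ : ∀ z, ‖fderiv ℝ (fderiv ℝ (fderiv ℝ (fderiv ℝ F))) z‖ ≤ M₄)
  (hM₅ : ∀ z, ‖fderiv ℝ (fderiv ℝ (fderiv ℝ (fderiv ℝ (fderiv ℝ F)))) z‖ ≤ M₅)

section Zero
include hF hM₁

/-- **Order 0**: `|F(γ_{K′}θ) − F(γ_Kθ)| ≤ 12.2·M₁·e`. [folklore] -/
theorem abs_comp_sub_le_graded_zero (θ : ℝ) :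
    |F (WithLp.toLp 2 (klFermiPoint ν K' θ)) - F (WithLp.toLp 2 (klFermiPoint ν K θ))| ≤ 12.2 * M₁ * e := by
  obtain ⟨-, -, -, d0, -⟩ := comp_graded_data hA hA' hA20 hd hlo hhi he hl hA₃ hA₃' hA₃l hA₄ hA₄' hA₄l hE₀ hE₁ hE₂ hE₃ hE₄ θ
  have hM0 : 0 ≤ M₁ := (norm_nonneg _).trans (hM₁ 0)
  have hmv := (convex_univ).norm_image_sub_le_of_norm_fderiv_le (𝕜 := ℝ) (f := F)
    (fun z _ => (hF.differentiable (by norm_num)) z) (fun z _ => hM₁ z) (mem_univ (WithLp.toLp 2 (klFermiPoint ν K θ)))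
    (mem_univ (WithLp.toLp 2 (klFermiPoint ν K' θ)))
  rw [Real.norm_eq_abs] at hmv
  refine hmv.trans ?_
  have := mul_le_mul_of_nonneg_left d0 hM0
  linarith

end Zero

include hF hM₁ hM₂ in
/-- **Order 1**: `|∂(F∘γ_{K′}) − ∂(F∘γ_K)| ≤ e·(3.78·10⁴·M₁λ + 2.82·10³·M₂)`. [folklore] -/
theorem abs_iteratedDeriv_comp_sub_le_graded_one (θ : ℝ) :
    |iteratedDeriv 1 (F ∘ fun θ : ℝ => (WithLp.toLp 2 (klFermiPoint ν K' θ) : Momentum)) θ -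
        iteratedDeriv 1 (F ∘ fun θ : ℝ => (WithLp.toLp 2 (klFermiPoint ν K θ) : Momentum)) θ| ≤
      e * (37800 * M₁ * l + 2820 * M₂) := by
  obtain ⟨hγ, hγ', ⟨-, g1', -, -, -, -, -⟩, d0, d1, -, -, -⟩ :=
    comp_graded_data hA hA' hA20 hd hlo hhi he hl hA₃ hA₃' hA₃l hA₄ hA₄' hA₄l hE₀ hE₁ hE₂ hE₃ hE₄ θ
  have hM₂0 : 0 ≤ M₂ := (norm_nonneg _).trans (hM₂ 0)
  have hΦ₁ := (norm_fderiv_sub_le_of_global hF hM₂ (WithLp.toLp 2 (klFermiPoint ν K' θ)) (WithLp.toLp 2 (klFermiPoint ν K θ))).trans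
    (mul_le_mul_of_nonneg_left d0 hM₂0)
  have h := abs_iteratedDeriv_one_comp_sub_le (hF.of_le (by norm_num)) hγ hγ' (hM₁ _) hΦ₁ g1' d1
  refine h.trans ?_
  nlinarith [mul_nonneg hM₂0 he]

include hF hM₁ hM₂ hM₃ in
/-- **Order 2**: `|∂²(F∘γ_{K′}) − ∂²(F∘γ_K)| ≤ e·(3.52·10⁸·M₁λ² + 2.61·10⁷·M₂λ + 6.52·10⁵·M₃)`. [folklore] -/
theorem abs_iteratedDeriv_comp_sub_le_graded_two (θ : ℝ) :
    |iteratedDeriv 2 (F ∘ fun θ : ℝ => (WithLp.toLp 2 (klFermiPoint ν K' θ) : Momentum)) θ -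
        iteratedDeriv 2 (F ∘ fun θ : ℝ => (WithLp.toLp 2 (klFermiPoint ν K θ) : Momentum)) θ| ≤
      e * (352000000 * M₁ * l ^ 2 + 26100000 * M₂ * l + 652000 * M₃) := by
  obtain ⟨hγ, hγ', ⟨g1, g1', -, g2', -, -, -⟩, d0, d1, d2, -, -⟩ :=
    comp_graded_data hA hA' hA20 hd hlo hhi he hl hA₃ hA₃' hA₃l hA₄ hA₄' hA₄l hE₀ hE₁ hE₂ hE₃ hE₄ θ
  have hM₂0 : 0 ≤ M₂ := (norm_nonneg _).trans (hM₂ 0)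
  have hM₃0 : 0 ≤ M₃ := (norm_nonneg _).trans (hM₃ 0)
  have hΦ₁ := (norm_fderiv_sub_le_of_global hF hM₂ (WithLp.toLp 2 (klFermiPoint ν K' θ)) (WithLp.toLp 2 (klFermiPoint ν K θ))).trans
    (mul_le_mul_of_nonneg_left d0 hM₂0)
  have hΦ₂ := (norm_fderiv_two_sub_le_of_global hF hM₃ (WithLp.toLp 2 (klFermiPoint ν K' θ))
    (WithLp.toLp 2 (klFermiPoint ν K θ))).trans (mul_le_mul_of_nonneg_left d0 hM₃0)
  have h := abs_iteratedDeriv_two_comp_sub_le (hF.of_le (by norm_num)) hγ hγ' (hM₁ _) (hM₂ _) hΦ₁ hΦ₂ g1 g1' g2' d1 d2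
  refine h.trans ?_
  have m01 : M₂ * (e * l ^ 0) ≤ M₂ * (e * l ^ 1) := graded_mono_mul hM₂0 he hl (by norm_num)
  simp only [pow_zero, mul_one, pow_one] at m01
  nlinarith [m01, mul_nonneg hM₃0 he, mul_nonneg hM₂0 he]

include hF hM₁ hM₂ hM₃ hM₄ in
/-- **Order 3**: `|∂³(F∘γ_{K′}) − ∂³(F∘γ_K)| ≤ e·(5.45·10¹²·M₁λ³ + 4.05·10¹¹·M₂λ² + 1.2·10¹⁰·M₃λ + 1.51·10⁸·M₄)`. [folklore] -/
theorem abs_iteratedDeriv_comp_sub_le_graded_three (θ : ℝ) :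
    |iteratedDeriv 3 (F ∘ fun θ : ℝ => (WithLp.toLp 2 (klFermiPoint ν K' θ) : Momentum)) θ -
        iteratedDeriv 3 (F ∘ fun θ : ℝ => (WithLp.toLp 2 (klFermiPoint ν K θ) : Momentum)) θ| ≤
      e * (5450000000000 * M₁ * l ^ 3 + 405000000000 * M₂ * l ^ 2 + 12000000000 * M₃ * l + 151000000 * M₄) := by
  obtain ⟨hγ, hγ', ⟨g1, g1', g2, g2', -, g3', -⟩, d0, d1, d2, d3, -⟩ :=
    comp_graded_data hA hA' hA20 hd hlo hhi he hl hA₃ hA₃' hA₃l hA₄ hA₄' hA₄l hE₀ hE₁ hE₂ hE₃ hE₄ θ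
  have hM₂0 : 0 ≤ M₂ := (norm_nonneg _).trans (hM₂ 0)
  have hM₃0 : 0 ≤ M₃ := (norm_nonneg _).trans (hM₃ 0)
  have hM₄0 : 0 ≤ M₄ := (norm_nonneg _).trans (hM₄ 0)
  have hΦ₁ := (norm_fderiv_sub_le_of_global hF hM₂ (WithLp.toLp 2 (klFermiPoint ν K' θ)) (WithLp.toLp 2 (klFermiPoint ν K θ))).trans
    (mul_le_mul_of_nonneg_left d0 hM₂0)
  have hΦ₂ := (norm_fderiv_two_sub_le_of_global hF hM₃ (WithLp.toLp 2 (klFermiPoint ν K' θ))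
    (WithLp.toLp 2 (klFermiPoint ν K θ))).trans (mul_le_mul_of_nonneg_left d0 hM₃0)
  have hΦ₃ := (norm_fderiv_three_sub_le_of_global hF hM₄ (WithLp.toLp 2 (klFermiPoint ν K' θ))
    (WithLp.toLp 2 (klFermiPoint ν K θ))).trans (mul_le_mul_of_nonneg_left d0 hM₄0)
  have h := abs_iteratedDeriv_three_comp_sub_le (hF.of_le (by norm_num)) hγ hγ' (hM₁ _) (hM₂ _) (hM₃ _) hΦ₁ hΦ₂ hΦ₃ g1 g1' g2 g2'
    g3' d1 d2 d3
  refine h.trans ?_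
  have hl0 : 0 ≤ l := zero_le_one.trans hl
  have m3 : M₃ * (e * l ^ 0) ≤ M₃ * (e * l ^ 1) := graded_mono_mul hM₃0 he hl (by norm_num)
  have m2a : M₂ * (e * l ^ 1) ≤ M₂ * (e * l ^ 2) := graded_mono_mul hM₂0 he hl (by norm_num)
  have m2b : M₂ * (e * l ^ 0) ≤ M₂ * (e * l ^ 2) := graded_mono_mul hM₂0 he hl (by norm_num)
  simp only [pow_zero, mul_one, pow_one] at m3 m2a m2b
  nlinarith [m3, m2a, m2b, mul_nonneg hM₄0 he, mul_nonneg hM₃0 he, mul_nonneg hM₂0 he, mul_nonneg (mul_nonneg hM₂0 he) hl0,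
    mul_nonneg (mul_nonneg hM₃0 he) hl0]
set_option maxHeartbeats 400000 in
include hF hM₁ hM₂ hM₃ hM₄ hM₅ in
/-- **Order 4**: `|∂⁴(F∘γ_{K′}) − ∂⁴(F∘γ_K)| ≤ e·(1.19·10¹⁷·M₁λ⁴ + 8.79·10¹⁵·M₂λ³ + 2.8·10¹⁴·M₃λ² + 4.6·10¹²·M₄λ + 3.48·10¹⁰·M₅)
+ 6.92·10¹⁰·M₁·A₄` (the last term: the fourth derivative of the base frame is bounded, not Lipschitz). [folklore] -/
theorem abs_iteratedDeriv_comp_sub_le_graded_four (θ : ℝ) :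
    |iteratedDeriv 4 (F ∘ fun θ : ℝ => (WithLp.toLp 2 (klFermiPoint ν K' θ) : Momentum)) θ -
        iteratedDeriv 4 (F ∘ fun θ : ℝ => (WithLp.toLp 2 (klFermiPoint ν K θ) : Momentum)) θ| ≤
      e * (119000000000000000 * M₁ * l ^ 4 + 8790000000000000 * M₂ * l ^ 3 + 280000000000000 * M₃ * l ^ 2 +
          4600000000000 * M₄ * l + 34800000000 * M₅) + 69200000000 * M₁ * A₄ := by
  obtain ⟨hγ, hγ', ⟨g1, g1', g2, g2', g3, g3', g4'⟩, d0, d1, d2, d3, d4⟩ :=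
    comp_graded_data hA hA' hA20 hd hlo hhi he hl hA₃ hA₃' hA₃l hA₄ hA₄' hA₄l hE₀ hE₁ hE₂ hE₃ hE₄ θ
  have hM₁0 : 0 ≤ M₁ := (norm_nonneg _).trans (hM₁ 0)
  have hM₂0 : 0 ≤ M₂ := (norm_nonneg _).trans (hM₂ 0)
  have hM₃0 : 0 ≤ M₃ := (norm_nonneg _).trans (hM₃ 0)
  have hM₄0 : 0 ≤ M₄ := (norm_nonneg _).trans (hM₄ 0)
  have hM₅0 : 0 ≤ M₅ := (ContinuousLinearMap.opNorm_nonneg _).trans (hM₅ 0)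
  have hΦ₁ := (norm_fderiv_sub_le_of_global hF hM₂ (WithLp.toLp 2 (klFermiPoint ν K' θ)) (WithLp.toLp 2 (klFermiPoint ν K θ))).trans
    (mul_le_mul_of_nonneg_left d0 hM₂0)
  have hΦ₂ := (norm_fderiv_two_sub_le_of_global hF hM₃ (WithLp.toLp 2 (klFermiPoint ν K' θ))
    (WithLp.toLp 2 (klFermiPoint ν K θ))).trans (mul_le_mul_of_nonneg_left d0 hM₃0)
  have hΦ₃ := (norm_fderiv_three_sub_le_of_global hF hM₄ (WithLp.toLp 2 (klFermiPoint ν K' θ))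
    (WithLp.toLp 2 (klFermiPoint ν K θ))).trans (mul_le_mul_of_nonneg_left d0 hM₄0)
  have hΦ₄ := (norm_fderiv_four_sub_le_of_global hF hM₅ (WithLp.toLp 2 (klFermiPoint ν K' θ))
    (WithLp.toLp 2 (klFermiPoint ν K θ))).trans (mul_le_mul_of_nonneg_left d0 hM₅0)
  have h := abs_iteratedDeriv_four_comp_sub_le (hF.of_le (by norm_num)) hγ hγ' (hM₁ _) (hM₂ _) (hM₃ _) (hM₄ _) hΦ₁ hΦ₂ hΦ₃ hΦ₄
    g1 g1' g2 g2' g3 g3' g4' d1 d2 d3 d4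
  refine h.trans ?_
  have hl0 : 0 ≤ l := zero_le_one.trans hl
  have m4 : M₄ * (e * l ^ 0) ≤ M₄ * (e * l ^ 1) := graded_mono_mul hM₄0 he hl (by norm_num)
  have m3a : M₃ * (e * l ^ 0) ≤ M₃ * (e * l ^ 2) := graded_mono_mul hM₃0 he hl (by norm_num)
  have m3b : M₃ * (e * l ^ 1) ≤ M₃ * (e * l ^ 2) := graded_mono_mul hM₃0 he hl (by norm_num)
  have m2 : M₂ * (e * l ^ 2) ≤ M₂ * (e * l ^ 3) := graded_mono_mul hM₂0 he hl (by norm_num)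
  simp only [pow_zero, mul_one, pow_one] at m4 m3a m3b
  nlinarith [m4, m3a, m3b, m2, mul_nonneg hM₅0 he, mul_nonneg hM₄0 he, mul_nonneg hM₃0 he, mul_nonneg hM₂0 he,
    mul_nonneg (mul_nonneg hM₂0 he) (pow_nonneg hl0 2), mul_nonneg (mul_nonneg hM₂0 he) (pow_nonneg hl0 3),
    mul_nonneg (mul_nonneg hM₃0 he) (pow_nonneg hl0 2), mul_nonneg (mul_nonneg hM₄0 he) hl0, mul_nonneg hM₁0 he]

end CompGraded

end Summit.HubbardSuperconductivity.HubbardSuperconductivity.Theorems.PerturbedFermiCurve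

end
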